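import Literature.MathematicalPhysics.QuantumChemistry.WeinholdWilsonInequalities
import Literature.MathematicalPhysics.QuantumChemistry.OnePositivityFromTwoPositivity
import Literature.MathematicalPhysics.QuantumChemistry.VariationalRDMRelaxation
import Literature.LinearAlgebra.Matrix.HermitianCfcDiagonalForm
import HarnessLib

/-!
# Ventures/CertifiedQuantumChemistry — Rows/StrongCouplingBookkeeping.lean: the hop / doublon / holon
# bookkeeping of the two-positivity programme (exact identities and the `2 × 2`-minor hop bound)

HONEST FRAMING (verbatim): certified bounds for a stated model Hamiltonian in a stated basis; not a
claim about the real molecule beyond that model.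

Seat rdm-B (gen 21), ROWS file: theorems only (no `def`, no notation), zero compute, nothing landed is
touched; the typer's adopt / refactor / retire word applies. Kernel-checked form of the EXACT identities and
the a-priori hop bound used in `HOME/STRUCTURE.md` §2.2.3 (the lead's `t/U` grading) and in rdm-B's
«STRUCTURE FEED F-5» (HOME/INBOX L676) — valid for EVERY feasible pair of the abstract programme
(`IsDQGFeasible` / `IsDQGFeasibleSector`; nothing about a state, a model or a file). Notation of the
docstrings: `d_i := ²D_{(i↑,i↓),(i↑,i↓)}` (doublon weight), `e_i := ²Q_{(i↑,i↓),(i↑,i↓)}` (holon weight,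
`²Q = qMap`), hop `γ_{iσ,jσ}` (`i ≠ j`).

* §1 `norm_apply_le_sqrt_of_posSemidef` — the `2 × 2` principal-minor bound `‖M_xy‖ ≤ √(Re M_xx · Re M_yy)`
  for a complex PSD matrix (the tree has the arithmetic-mean form `norm_apply_le_of_posSemidef`; the
  geometric-mean form is what small diagonals need).
* §2 EXACT LINEAR IDENTITIES (`qMap` / `gMap` read off): **`one_hop_eq_two_sub_qMap`** — for `σ ≠ τ`, `i ≠ j`:
  `γ_{iσ,jσ} = ²D_{(iσ,iτ),(jσ,iτ)} − ²Q_{(jσ,iτ),(iσ,iτ)}` (the hop is the DOUBLON-TYPE hop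
  `⟨c†_{iσ} n_{iτ} c_{jσ}⟩` minus the HOLON-TYPE entry of the two-hole matrix — the operator identity
  `c†c = c† n c + c†(1 − n) c` at pair level); `qMap_apply_sameSite` (`e_i = 1 − γ_{i↑,i↑} − γ_{i↓,i↓} + d_i`,
  = the tree's `qMap_apply_diag`); **`sum_holon_sub_sum_doublon`** — on the `(a, b)` sector programme
  `Σ_i e_i − Σ_i d_i = |Λ| − (a + b)` (so AT HALF FILLING total holon weight = total doublon weight).
* §3 THE HOP BOUND: `two_diag_re_le_one_diag_re` (`Re ²D_{(p,q),(p,q)} ≤ Re γ_pp`, the `G`-diagonal),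
  `qMap_diag_re_le_one`, and **`norm_one_hop_le`** —
  `‖γ_{iσ,jσ}‖ ≤ √(Re d_i^{στ} · Re ²D_{(jσ,iτ),(jσ,iτ)}) + √(Re ²Q_{(jσ,iτ),(jσ,iτ)} · Re e_i^{στ})`, with the
  corollary **`norm_one_hop_le_sqrt_add_sqrt`** `‖γ_{iσ,jσ}‖ ≤ √(Re d_i^{στ}) + √(Re e_i^{στ})` when
  `N + 2 ≤ 2|Λ|` (occupations `≤ 1`): a feasible point can only hop as much as it pays in doublon AND holon
  weight — the constraint behind 'energy ≤ 0 ⇒ Σ d = O(t²/U²)' on the Hubbard files.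

Everything is PROVED (0 sorry, standard axioms); no definitions, no named facts; nothing asserts a bound
about any model; no claim node / hint / row / CERTIFIED cell depends on it.

References: D. A. Mazziotti, Adv. Chem. Phys. 134 (2007) ch. 3 §II.B eqs. (14)–(17) (`Q`, `G` maps,
contraction); R. A. Horn, C. R. Johnson, *Matrix Analysis* (2nd ed. 2013) §7.1 Obs. 7.1.2 (principal minors
of PSD matrices); B. Verstichel, H. van Aggelen, W. Poelmans, D. Van Neck, P. Bultinck, Phys. Rev. Lett. 108
(2012) 213001 (arXiv:1110.5732; doublon elements of the PQG optimum at large `U`). Tree (REUSED): `qMap_apply`,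
`gMap_apply`, `qMap_apply_diag`, `gMap_apply_diag`, `IsDQGFeasible.diag_nonneg`, `IsDQGFeasible.diag_le_one`,
`IsDQGFeasibleSector.trace_up/down`, `star_dotProduct_mulVec_single_add_single`,
`Literature.LinearAlgebra.Matrix.norm_apply_le_of_posSemidef` (typer / Literature). Mathlib:
`Matrix.PosSemidef.diag_nonneg`, `Complex.nonneg_iff`, `Real.sqrt_le_sqrt`, `Real.le_sqrt`.
-/

noncomputable section

namespace Summit.Ventures.CertifiedQuantumChemistry

open Matrix Finset
open Literature.MathematicalPhysics.QuantumLattice Literature.MathematicalPhysics.QuantumChemistry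
open scoped ComplexOrder

/-! ### §1 The geometric-mean `2 × 2` minor bound -/

section Minor

variable {n : Type*} [Fintype n] [DecidableEq n]

/-- **`‖M_xy‖ ≤ √(Re M_xx · Re M_yy)` for a complex positive-semidefinite matrix** (geometric-mean form
of the `2 × 2` principal-minor bound; the tree's `norm_apply_le_of_posSemidef` is the arithmetic-mean form,
and the squared form lives in a Hubbard-summit Theorems file not imported here). Horn–Johnson Obs. 7.1.2. -/
theorem norm_apply_le_sqrt_of_posSemidef {M : Matrix n n ℂ} (hM : M.PosSemidef) (x y : n) :
    ‖M x y‖ ≤ Real.sqrt ((M x x).re * (M y y).re) := by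
  suffices hsq : ‖M x y‖ ^ 2 ≤ (M x x).re * (M y y).re by
    calc ‖M x y‖ = Real.sqrt (‖M x y‖ ^ 2) := (Real.sqrt_sq (norm_nonneg _)).symm
      _ ≤ _ := Real.sqrt_le_sqrt hsq
  have ha := Complex.nonneg_iff.1 (hM.diag_nonneg (i := x))
  have hc := Complex.nonneg_iff.1 (hM.diag_nonneg (i := y))
  have hyx : M y x = star (M x y) := by
    have h := hM.isHermitian.apply y x
    rw [← h]
  -- the quadratic form on `e_x + t e_y`
  have hq : ∀ t : ℂ, 0 ≤ (M x x).re + 2 * (t * M x y).re + ‖t‖ ^ 2 * (M y y).re := by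
    intro t
    have h := Complex.nonneg_iff.1 (hM.dotProduct_mulVec_nonneg (Pi.single x 1 + Pi.single y t))
    rw [Literature.LinearAlgebra.Matrix.star_dotProduct_mulVec_single_add_single] at h
    have hre : ((star (1 : ℂ)) * 1 * M x x + star (1 : ℂ) * t * M x y + star t * 1 * M y x +
        star t * t * M y y).re = (M x x).re + 2 * (t * M x y).re + ‖t‖ ^ 2 * (M y y).re := by
      rw [hyx]
      have h1 : star t * t = ((‖t‖ ^ 2 : ℝ) : ℂ) := by
        rw [Complex.star_def, Complex.conj_mul', Complex.ofReal_pow]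
      rw [h1, star_one, one_mul, one_mul, mul_one]
      simp only [Complex.add_re, Complex.re_ofReal_mul]
      have h2 : (star t * star (M x y)).re = (t * M x y).re := by
        rw [← star_mul', Complex.star_def, Complex.conj_re, mul_comm]
      rw [h2]
      ring
    rw [hre] at h
    exact h.1
  -- scalar Cauchy–Schwarz from the quadratic inequality
  set a := (M x x).re
  set c := (M y y).re
  set b := M x y
  have hb2 : ∀ s : ℝ, ((-(s : ℂ) * star b) * b).re = -(s * ‖b‖ ^ 2) := by
    intro s
    rw [mul_assoc, Complex.star_def, Complex.conj_mul', neg_mul, Complex.neg_re, ← Complex.ofReal_pow,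
      ← Complex.ofReal_mul, Complex.ofReal_re]
  have hn2 : ∀ s : ℝ, ‖-(s : ℂ) * star b‖ ^ 2 = s ^ 2 * ‖b‖ ^ 2 := by
    intro s
    rw [norm_mul, norm_neg, Complex.norm_real, norm_star, mul_pow, Real.norm_eq_abs, sq_abs]
  rcases hc.1.lt_or_eq with hcpos | hc0
  · -- `c > 0`: `t = − conj b / c`
    have key := hq (-((1 / c : ℝ) : ℂ) * star b)
    rw [hb2, hn2] at key
    have : (M x x).re + 2 * -(1 / c * ‖b‖ ^ 2) + (1 / c) ^ 2 * ‖b‖ ^ 2 * c = a - ‖b‖ ^ 2 / c := by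
      field_simp
      ring
    rw [this, sub_nonneg, div_le_iff₀ hcpos] at key
    linarith
  · -- `c = 0`: then `b = 0`
    rw [← hc0, mul_zero]
    suffices h0 : ‖b‖ ^ 2 = 0 by rw [h0]
    by_contra hne
    have hpos : 0 < ‖b‖ ^ 2 := lt_of_le_of_ne (sq_nonneg _) (Ne.symm hne)
    have key := hq (-((a / ‖b‖ ^ 2 + 1 : ℝ) : ℂ) * star b)
    rw [hb2, hn2, ← hc0, mul_zero, add_zero] at key
    have : (a / ‖b‖ ^ 2 + 1) * ‖b‖ ^ 2 = a + ‖b‖ ^ 2 := by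
      rw [add_mul, one_mul, div_mul_cancel₀ a (ne_of_gt hpos)]
    nlinarith [this, ha.1]

end Minor

/-! ### §2 Exact identities: hop = doublon-type − holon-type; holon and doublon weights -/

section Identities

variable {Λ : Type*} [LinearOrder Λ] [Fintype Λ]
variable (γ : Matrix (Orb Λ) (Orb Λ) ℂ) (Γ : Matrix (Orb Λ × Orb Λ) (Orb Λ × Orb Λ) ℂ)

omit [Fintype Λ] in
/-- **The hop is the doublon-type hop minus the holon-type two-hole entry**: for `σ ≠ τ` and `i ≠ j`,
`γ_{iσ,jσ} = ²D_{(iσ,iτ),(jσ,iτ)} − ²Q_{(jσ,iτ),(iσ,iτ)}` — the pair-level form of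
`c†_{iσ}c_{jσ} = c†_{iσ} n_{iτ} c_{jσ} + c†_{iσ}(1 − n_{iτ}) c_{jσ}`, read off Mazziotti's `Q`-map (14);
valid for every pair `(γ, Γ)`, feasible or not. -/
theorem one_hop_eq_two_sub_qMap {i j : Λ} {σ τ : Fin 2} (hστ : σ ≠ τ) (hij : i ≠ j) :
    γ (orb i σ) (orb j σ) =
      Γ (orb i σ, orb i τ) (orb j σ, orb i τ) - qMap γ Γ (orb j σ, orb i τ) (orb i σ, orb i τ) := by
  rw [qMap_apply]
  have h1 : orb j σ ≠ orb i σ := fun h => hij ((orb_inj.1 h).1.symm)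
  have h2 : orb j σ ≠ orb i τ := fun h => hστ (orb_inj.1 h).2
  have h3 : orb i τ ≠ orb i σ := fun h => hστ (orb_inj.1 h).2.symm
  simp only [h1, h2, h3, if_false, if_true, zero_mul, mul_zero, sub_zero, one_mul, add_zero]
  ring

omit [Fintype Λ] in
/-- **Holon weight in terms of occupations and doublon weight**: `e_i = 1 − γ_{iσ,iσ} − γ_{iτ,iτ} + d_i`
(`σ ≠ τ`; the tree's `qMap_apply_diag` at the same-site pair). -/
theorem qMap_apply_sameSite (i : Λ) {σ τ : Fin 2} (hστ : σ ≠ τ) :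
    qMap γ Γ (orb i σ, orb i τ) (orb i σ, orb i τ) =
      1 - γ (orb i σ) (orb i σ) - γ (orb i τ) (orb i τ) + Γ (orb i σ, orb i τ) (orb i σ, orb i τ) :=
  qMap_apply_diag γ Γ fun h => hστ (orb_inj.1 h).2

/-- **Total holon weight minus total doublon weight is `|Λ| − N`** on the `(a, b)` sector programme:
`Σ_i e_i − Σ_i d_i = |Λ| − (a + b)`; at half filling (`a + b = |Λ|`) the two totals are EQUAL — for every
feasible pair, not only for states. -/
theorem sum_holon_sub_sum_doublon {a b : ℕ} (hf : IsDQGFeasibleSector a b γ Γ) :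
    ∑ i : Λ, qMap γ Γ (orb i 0, orb i 1) (orb i 0, orb i 1) -
        ∑ i : Λ, Γ (orb i 0, orb i 1) (orb i 0, orb i 1) = (Fintype.card Λ : ℂ) - ((a : ℂ) + b) := by
  have h01 : (0 : Fin 2) ≠ 1 := by decide
  simp only [qMap_apply_sameSite γ Γ _ h01]
  rw [← Finset.sum_sub_distrib]
  simp only [add_sub_cancel_right, Finset.sum_sub_distrib, Finset.sum_const, Finset.card_univ,
    nsmul_eq_mul, mul_one, hf.trace_up, hf.trace_down]
  ring

/-- Half filling: `Σ_i e_i = Σ_i d_i` when `a + b = |Λ|`. -/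
theorem sum_holon_eq_sum_doublon {a b : ℕ} (hf : IsDQGFeasibleSector a b γ Γ) (hN : a + b = Fintype.card Λ) :
    ∑ i : Λ, qMap γ Γ (orb i 0, orb i 1) (orb i 0, orb i 1) = ∑ i : Λ, Γ (orb i 0, orb i 1) (orb i 0, orb i 1) := by
  have h := sum_holon_sub_sum_doublon γ Γ hf
  rw [← Nat.cast_add, hN, sub_self] at h
  exact sub_eq_zero.1 h

end Identities

/-! ### §3 The hop bound -/

section HopBound

variable {Λ : Type*} [LinearOrder Λ] [Fintype Λ]
variable {γ : Matrix (Orb Λ) (Orb Λ) ℂ} {Γ : Matrix (Orb Λ × Orb Λ) (Orb Λ × Orb Λ) ℂ} {N : ℕ}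

/-- **`Re ²D_{(p,q),(p,q)} ≤ Re γ_pp`** (the diagonal of the `G`-map is non-negative). -/
theorem two_diag_re_le_one_diag_re (hf : IsDQGFeasible N γ Γ) (p q : Orb Λ) :
    (Γ (p, q) (p, q)).re ≤ (γ p p).re := by
  have h := Complex.nonneg_iff.1 (hf.g_psd.diag_nonneg (i := (p, q)))
  rw [gMap_apply_diag, Complex.sub_re] at h
  linarith [h.1]

/-- **`Re ²Q_{(p,q),(p,q)} ≤ 1`** for `p ≠ q` (`Q_pp = 1 − γ_pp − γ_qq + D_pp`, `γ_qq ≥ 0`, `D_pp ≤ γ_pp`). -/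
theorem qMap_diag_re_le_one (hf : IsDQGFeasible N γ Γ) {p q : Orb Λ} (hpq : p ≠ q) :
    (qMap γ Γ (p, q) (p, q)).re ≤ 1 := by
  rw [qMap_apply_diag γ Γ hpq]
  simp only [Complex.add_re, Complex.sub_re, Complex.one_re]
  linarith [two_diag_re_le_one_diag_re hf p q, (hf.diag_nonneg q).1]

/-- **`Re ²D_{(p,q),(p,q)} ≤ 1`** when occupations are `≤ 1` (`N + 2 ≤ 2|Λ|`). -/
theorem two_diag_re_le_one (hf : IsDQGFeasible N γ Γ) (hr : N + 2 ≤ Fintype.card (Orb Λ)) (p q : Orb Λ) :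
    (Γ (p, q) (p, q)).re ≤ 1 :=
  (two_diag_re_le_one_diag_re hf p q).trans (hf.diag_le_one hr p)

/-- **THE HOP BOUND**: for `σ ≠ τ`, `i ≠ j` and every DQG-feasible pair,
`‖γ_{iσ,jσ}‖ ≤ √(Re ²D_{(iσ,iτ),(iσ,iτ)} · Re ²D_{(jσ,iτ),(jσ,iτ)}) + √(Re ²Q_{(jσ,iτ),(jσ,iτ)} · Re ²Q_{(iσ,iτ),(iσ,iτ)})`
— the hop splits into its doublon-type and holon-type parts (§2) and each is a `2 × 2` minor of `D ⪰ 0`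
resp. `Q ⪰ 0` against the doublon weight `d_i` resp. the holon weight `e_i` of site `i`. -/
theorem norm_one_hop_le (hf : IsDQGFeasible N γ Γ) {i j : Λ} {σ τ : Fin 2} (hστ : σ ≠ τ) (hij : i ≠ j) :
    ‖γ (orb i σ) (orb j σ)‖ ≤
      Real.sqrt ((Γ (orb i σ, orb i τ) (orb i σ, orb i τ)).re * (Γ (orb j σ, orb i τ) (orb j σ, orb i τ)).re) +
        Real.sqrt ((qMap γ Γ (orb j σ, orb i τ) (orb j σ, orb i τ)).re *
          (qMap γ Γ (orb i σ, orb i τ) (orb i σ, orb i τ)).re) := by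
  rw [one_hop_eq_two_sub_qMap γ Γ hστ hij]
  refine (norm_sub_le _ _).trans (add_le_add ?_ ?_)
  · exact norm_apply_le_sqrt_of_posSemidef hf.d_psd _ _
  · exact norm_apply_le_sqrt_of_posSemidef hf.q_psd _ _

/-- **Corollary** (`N + 2 ≤ 2|Λ|`, so that occupations are `≤ 1`): `‖γ_{iσ,jσ}‖ ≤ √(Re d_i^{στ}) + √(Re e_i^{στ})`
with `d_i^{στ} = ²D_{(iσ,iτ),(iσ,iτ)}`, `e_i^{στ} = ²Q_{(iσ,iτ),(iσ,iτ)}` — a feasible point hops between `i`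
and `j` at most by the square roots of the doublon and holon weights it carries at `i`. -/
theorem norm_one_hop_le_sqrt_add_sqrt (hf : IsDQGFeasible N γ Γ) (hr : N + 2 ≤ Fintype.card (Orb Λ))
    {i j : Λ} {σ τ : Fin 2} (hστ : σ ≠ τ) (hij : i ≠ j) :
    ‖γ (orb i σ) (orb j σ)‖ ≤
      Real.sqrt (Γ (orb i σ, orb i τ) (orb i σ, orb i τ)).re +
        Real.sqrt (qMap γ Γ (orb i σ, orb i τ) (orb i σ, orb i τ)).re := by
  have hd0 : 0 ≤ (Γ (orb i σ, orb i τ) (orb i σ, orb i τ)).re :=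
    (Complex.nonneg_iff.1 (hf.d_psd.diag_nonneg (i := (orb i σ, orb i τ)))).1
  have he0 : 0 ≤ (qMap γ Γ (orb i σ, orb i τ) (orb i σ, orb i τ)).re :=
    (Complex.nonneg_iff.1 (hf.q_psd.diag_nonneg (i := (orb i σ, orb i τ)))).1
  have hji : orb j σ ≠ orb i τ := fun h => hστ (orb_inj.1 h).2
  have hD1 := two_diag_re_le_one hf hr (orb j σ) (orb i τ)
  have hQ1 := qMap_diag_re_le_one hf hji
  refine (norm_one_hop_le hf hστ hij).trans (add_le_add ?_ ?_)
  · refine Real.sqrt_le_sqrt ?_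
    calc _ ≤ (Γ (orb i σ, orb i τ) (orb i σ, orb i τ)).re * 1 := mul_le_mul_of_nonneg_left hD1 hd0
      _ = _ := mul_one _
  · refine Real.sqrt_le_sqrt ?_
    calc _ ≤ 1 * (qMap γ Γ (orb i σ, orb i τ) (orb i σ, orb i τ)).re := mul_le_mul_of_nonneg_right hQ1 he0
      _ = _ := one_mul _

end HopBound

end Summit.Ventures.CertifiedQuantumChemistry

end
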